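import Summits.CriticalPhenomena.PercolationContinuityZ3.Theses.PercExchangeRateTransport
import Summits.CriticalPhenomena.PercolationContinuityZ3.Theorems.PercExchangeRateTransportSubcritExchangeUniformityStubSlopePositiveOnCurve
import Summits.CriticalPhenomena.PercolationContinuityZ3.Theorems.PercExchangeRateTransportSubcritExchangeUniformityCurveRatioLimitOfItems
import Summits.CriticalPhenomena.PercolationContinuityZ3.Theorems.PercExchangeRateTransportCriticalCurveRegular

/-!
# Line `onesided` — alternative skeleton for the crux `SubcritExchangeUniformity`
# (stmt-CriticalPhenomena-16062, route `PercExchangeRateTransport`, rank 3, "K⁻")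

## LEAD STATUS (prover-line-stmt-CriticalPhenomena-16062-c1, cycle 2, 2026-08-17T20:00Z)

* THE ONE-SIDED REDUCTION IS KERNEL-CHECKED (this cycle; namespace
  `…Theorems.SubcritExchangeUniformity.TransportMono`, all `--supports` this item): `fence_monotoneOn_lower` +
  `upperFenceMono` (p172389), `levelTransportMono` (p172745), `rightCollar_moduli` (p172345),
  `curveMonotone_of_lowerHalf : TransportLemmaMono → K⁺ → Sig.stub_lowerSubcurveBound → J nonincreasing` (p172562),
  `percolationContinuityZ3_of_curveMonotone : J nonincreasing → PercolationContinuityZ3` (p172439); assembly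
  `transportLemmaMono` (= the `Prop` `TransportLemmaMono` of §5, PROVED) and the headline
  `percolationContinuityZ3_of_supercrit_lowerHalf : K⁺ → Sig.stub_lowerSubcurveBound → PercolationContinuityZ3` follow.
  Hence ONLY `stub_lowerSubcurveBound` of this line is on the route's critical path; `stub_upperSubcurveBound`, the
  continuity of `σ` and `p_c ∈ C¹` are not (tenure: restate K⁻ ↦ `Sig.stub_lowerSubcurveBound`).
* stub_slopePositiveOnCurve — CLOSED (p168651; helpers BoxLaw p166606, RussoPos p168442, IsotropicAnchor p169051).
* stub_curveRatioLimit — OPEN modulo the sibling crux K⁺ ONLY (`curveRatioLimit_of_items`, p166335; CCR proved in tree).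
* stub_lowerSubcurveBound (lead), stub_upperSubcurveBound — OPEN MATHEMATICS (near-critical window-to-OZ crossover of
  pivotal intensities in d = 3; presearch: nothing in print; cdisprove cycle 1: NO KILL; MC consistent).
* Route context: TransportLemma (16063), ModelFacts (16064), CriticalCurveRegular (16065), CurveInvariance (16068) are
  all PROVED; the route's `closes` rests on K⁺ (16061) and K⁻ (this crux) — and, by the reduction above, on K⁺ and
  `stub_lowerSubcurveBound` alone.
* Registration note: the three open stubs are registered with their full ONE-LINE `;`-joined let-form signatures
  (the headers below are written as that one line; `--supports` files must copy the header byte-for-byte).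

Strategist line (crux-strategist, 2026-08-17), registered `--alt` next to `Lines/birth.lean`.

Crux (fixed, by name): `PercExchangeRateTransport.SubcritExchangeUniformity` — K⁻: in the
label-coupled anisotropic bond family on `ℤ²×ℤ` (an `x`/`y`-bond open iff `U ≤ p`, a `z`-bond iff
`U ≤ t`; `Θ_n(p,t) = P(0 ↔ ∂Λ_n)`, critical curve `p_c(t)`), for every compact sub-arc
`[lo,hi] ⊂ (0,1)` there is a continuous `σ` with
`|∂_tΘ_n(p,t) − σ(t) ∂_pΘ_n(p,t)| ≤ η ∂_pΘ_n(p,t)` for `n ≥ m(η)`, `t ∈ [lo,hi]`,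
`p_c(t) − δ(η) ≤ p ≤ p_c(t)`.

## THE CUT — along the load-bearing seam of the route's deciding theorem

The route's `closes` needs `J(p₃) ≤ J(lo)` for `lo < p₃` only, i.e. that the critical jump
`J(t) = θ(p_c(t),t)` is NONINCREASING in `t`; the transport argument for that direction consumes,
from below the curve, ONLY A ONE-SIDED LOWER BOUND on the exchange rate (see §5,
`TransportLemmaMono`, the typed one-sided transport lemma: forward Euler polygons of slope
`−(a+2η)` started above the curve carry an upper bound on `θ` and may be restarted DOWNWARDS for
free; what must be excluded is the curve coming up to meet them, i.e. one needs the UPPER PINCH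
`p_c(t) ≤ p_c(t₀) − (a(p_c t₀,t₀) − 2η)(t − t₀)` locally, which is positivity propagation along
test segments of slope `−(a−2η)` — and a test segment that dips below the curve keeps `Θ_n`
nondecreasing iff `a_n ≥ a − 2η` THERE: the LOWER sub-curve bound. The mirror UPPER sub-curve bound
is consumed only by the LOWER pinch `p_c(t) ≥ p_c(t₀) − (a+2η)(t−t₀)`, i.e. by `p_c ∈ C¹` and by
the unused direction "J nondecreasing"). Moreover K⁺ (`SupercritExchangeUniformity`, the sibling
crux, rank 2) is stated on the CLOSED supercritical collar, curve included, so the on-curve ratio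
limit (birth's `stub_curveRatioLimit`) is a by-name consequence of K⁺ ∧ `CriticalCurveRegular`
(`curveRatioLimit_of_items`, proved below). Hence, relative to the route, the whole residual
content of K⁻ is the two one-sided sub-curve bounds, and only the lower one is load-bearing:

* `stub_curveRatioLimit` (SHARED with `Lines/birth.lean`, same statement; by-name consequence of
  the route items `SupercritExchangeUniformity ∧ CriticalCurveRegular` — `curveRatioLimit_of_items`):
  on the curve `a_n(p_c(t),t) → σ(t)` uniformly on `[lo,hi]`, `σ` continuous.
* `stub_lowerSubcurveBound` (OPEN — THE LOAD-BEARING HALF for `closes`): for `n ≥ m(η)`,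
  `t ∈ [lo,hi]`, `p_c(t) − δ(η) ≤ p ≤ p_c(t)`:
  `∂_tΘ_n(p_c t,t) ∂_pΘ_n(p,t) − η ∂_pΘ_n(p,t) ∂_pΘ_n(p_c t,t) ≤ ∂_tΘ_n(p,t) ∂_pΘ_n(p_c t,t)`,
  i.e. `a_n(p,t) ≥ a_n(p_c(t),t) − η` (cross-multiplied: no division, no junk). Approaching the
  curve from the subcritical side a `z`-bond never becomes asymptotically CHEAPER (relative to an
  `x,y`-bond) than it is on the curve.
* `stub_upperSubcurveBound` (OPEN — needed for K⁻ AS TYPED and for `p_c ∈ C¹`, NOT for `closes`):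
  the mirror inequality `a_n(p,t) ≤ a_n(p_c(t),t) + η`, cross-multiplied.
* `stub_slopePositiveOnCurve` (SHARED with `Lines/birth.lean`; by-name support from
  `ModelFacts ∧ CriticalCurveRegular` — `slopePositiveOnCurve_of_items`): `0 < ∂_pΘ_n(p_c(t),t)`
  for `n ≥ 1`.
* `SubcritExchangeUniformity_of : Sig.stub_curveRatioLimit → Sig.stub_lowerSubcurveBound →
  Sig.stub_upperSubcurveBound → Sig.stub_slopePositiveOnCurve → SubcritExchangeUniformity`
  (hypotheses the stub `Prop`s BY NAME, conclusion the route decl BY NAME; real proof via the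
  percolation-free `onesided_glue`).

SEPARATION. K⁻ ⟹ each stub (stub 1: `p = p_c(t)`; stubs 2/3: triangle inequality, given stub 4).
Stub 2 ∧ ¬stub 3 and stub 3 ∧ ¬stub 2 are both consistent with stubs 1, 4 (a one-signed
non-flattening crossover germ), so neither one-sided half is the crux reworded; the two halves
play DIFFERENT roles downstream (§5), which is the point of the cut. BC3-type probes
(`stub → crux`, `stub → PercolationContinuityZ3` by `exact? | simpa | unfold; simpa | aesop`) fail
for stubs 2, 3 (strategist folder `bc/`); stubs 1, 4 were probed at birth registration.

DISPROOF USED: none exists for this item (no `Disproof.lean`, no `_false_without_` theorem, no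
landed `Negative/` lemma, 2026-08-17). Negatives index: nothing on exchange rates / pivotal
intensities / anisotropic curves. Dead lines: none.

Degenerate parameters: as in `Lines/birth.lean` (`δ` existential so the prover keeps `p > 0`;
`n = 0` harmless in stubs 1–3 and excluded from stub 4; all `deriv`s are genuine partials of
polynomials on the open square).
-/

noncomputable section

namespace Summit.CriticalPhenomena.PercolationContinuityZ3.Cruxes.SubcritExchangeUniformity.Onesided

open MeasureTheory
open Literature.Probability.Percolation Literature.Probability.LatticeModels
open Summit.CriticalPhenomena.PercolationContinuityZ3.Theses.PercExchangeRateTransport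
  (SubcritExchangeUniformity SupercritExchangeUniformity ModelFacts CriticalCurveRegular)

/-! ## §0 Objects of the line (the crux's own `let`s, named — verbatim as in `Lines/birth.lean`) -/

/-- The law of the i.i.d. uniform labels on the bonds of `ℤ³`. -/
abbrev μ : Measure (Sym2 (Site 3) → ℝ) := labelMeasure (Site 3)

/-- `e` is a vertical (`z`-) bond: `e = {x, x + e₃}`. -/
def IsVert (e : Sym2 (Site 3)) : Prop := ∃ x : Site 3, e = s(x, x + Pi.single (2 : Fin 3) 1)

/-- The label-coupled anisotropic configuration at `(p,t)`: horizontal bonds open iff `U ≤ p`,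
vertical bonds iff `U ≤ t`. -/
def cfgPT (p t : ℝ) (U : Sym2 (Site 3) → ℝ) : Set (Sym2 (Site 3)) :=
  {e | e ∈ (zdGraph 3).edgeSet ∧ ((IsVert e ∧ U e ≤ t) ∨ (¬ IsVert e ∧ U e ≤ p))}

/-- `Θ_n(p,t) = P(0 ↔ ∂Λ_n)`. -/
def ThetaBox (n : ℕ) (p t : ℝ) : ℝ := μ.real {U | cfgPT p t U ∈ siteToBoundary 3 n}

/-- `θ(p,t) = P(|C(0)| = ∞)`. -/
def thetaPerc (p t : ℝ) : ℝ := μ.real {U | cfgPT p t U ∈ percolatesAt (0 : Site 3)}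

/-- The anisotropic critical curve `p_c(t)`. -/
def pcurve (t : ℝ) : ℝ := sInf ({p : ℝ | 0 ≤ p ∧ p ≤ 1 ∧ 0 < thetaPerc p t} ∪ {1})

/-- `∂_pΘ_n(p,t)`, the horizontal Russo intensity. -/
def dP (n : ℕ) (p t : ℝ) : ℝ := deriv (fun q => ThetaBox n q t) p

/-- `∂_tΘ_n(p,t)`, the vertical Russo intensity. -/
def dT (n : ℕ) (p t : ℝ) : ℝ := deriv (fun s => ThetaBox n p s) t

/-- The crux, literally, over the local names (by `Iff.rfl`). -/
theorem subcritExchangeUniformity_iff :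
    SubcritExchangeUniformity ↔
      ∀ lo hi : ℝ, 0 < lo → lo < hi → hi < 1 → ∃ σ : ℝ → ℝ, ContinuousOn σ (Set.Icc lo hi) ∧
        ∀ η > (0 : ℝ), ∃ δ > (0 : ℝ), ∃ m : ℕ, ∀ n ≥ m, ∀ t ∈ Set.Icc lo hi, ∀ p : ℝ,
          pcurve t - δ ≤ p → p ≤ pcurve t →
            |dT n p t - σ t * dP n p t| ≤ η * dP n p t :=
  Iff.rfl

/-- The sibling crux K⁺, literally, over the local names (by `Iff.rfl`). -/
theorem supercritExchangeUniformity_iff :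
    SupercritExchangeUniformity ↔
      ∀ lo hi : ℝ, 0 < lo → lo < hi → hi < 1 → ∃ ρ > (0 : ℝ), ∃ L : ℝ, ∃ a : ℝ → ℝ → ℝ,
        ContinuousOn (fun x : ℝ × ℝ => a x.1 x.2)
            {x : ℝ × ℝ | x.2 ∈ Set.Icc lo hi ∧ pcurve x.2 ≤ x.1 ∧ x.1 ≤ pcurve x.2 + ρ} ∧
          (∀ t ∈ Set.Icc lo hi, ∀ p q : ℝ, pcurve t ≤ p → p ≤ pcurve t + ρ → pcurve t ≤ q →
            q ≤ pcurve t + ρ → |a p t - a q t| ≤ L * |p - q|) ∧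
          ∀ η > (0 : ℝ), ∃ m : ℕ, ∀ n ≥ m, ∀ t ∈ Set.Icc lo hi, ∀ p : ℝ, pcurve t ≤ p →
            p ≤ pcurve t + ρ → |dT n p t - a p t * dP n p t| ≤ η * dP n p t :=
  Iff.rfl

/-- The route item `CriticalCurveRegular`, literally, over the local names (by `Iff.rfl`). -/
theorem criticalCurveRegular_iff :
    CriticalCurveRegular ↔
      ContinuousOn pcurve (Set.Ioo 0 1) ∧ ∀ t ∈ Set.Ioo (0 : ℝ) 1, 0 < pcurve t ∧ pcurve t < 1 :=
  Iff.rfl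

/-! ## §1 The four stub statements — readable local form -/

/-- STUB 1 statement (shared with `birth`): on-curve exchange-rate limit, uniform on compact
sub-arcs, continuous limit. -/
def CurveRatioLimit : Prop :=
  ∀ lo hi : ℝ, 0 < lo → lo < hi → hi < 1 → ∃ σ : ℝ → ℝ, ContinuousOn σ (Set.Icc lo hi) ∧
    ∀ η > (0 : ℝ), ∃ m : ℕ, ∀ n ≥ m, ∀ t ∈ Set.Icc lo hi,
      |dT n (pcurve t) t - σ t * dP n (pcurve t) t| ≤ η * dP n (pcurve t) t

/-- STUB 2 statement: one-sided LOWER bound on the exchange rate from below the curve, relative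
to its on-curve value at the same `n` (cross-multiplied): `a_n(p,t) ≥ a_n(p_c(t),t) − η`. -/
def LowerSubcurveBound : Prop :=
  ∀ lo hi : ℝ, 0 < lo → lo < hi → hi < 1 →
    ∀ η > (0 : ℝ), ∃ δ > (0 : ℝ), ∃ m : ℕ, ∀ n ≥ m, ∀ t ∈ Set.Icc lo hi, ∀ p : ℝ,
      pcurve t - δ ≤ p → p ≤ pcurve t →
        dT n (pcurve t) t * dP n p t - η * dP n p t * dP n (pcurve t) t ≤
          dT n p t * dP n (pcurve t) t

/-- STUB 3 statement: one-sided UPPER bound on the exchange rate from below the curve, relative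
to its on-curve value at the same `n` (cross-multiplied): `a_n(p,t) ≤ a_n(p_c(t),t) + η`. -/
def UpperSubcurveBound : Prop :=
  ∀ lo hi : ℝ, 0 < lo → lo < hi → hi < 1 →
    ∀ η > (0 : ℝ), ∃ δ > (0 : ℝ), ∃ m : ℕ, ∀ n ≥ m, ∀ t ∈ Set.Icc lo hi, ∀ p : ℝ,
      pcurve t - δ ≤ p → p ≤ pcurve t →
        dT n p t * dP n (pcurve t) t ≤
          dT n (pcurve t) t * dP n p t + η * dP n p t * dP n (pcurve t) t

/-- STUB 4 statement (shared with `birth`): the horizontal Russo intensity is positive at the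
curve. -/
def SlopePositiveOnCurve : Prop :=
  ∀ lo hi : ℝ, 0 < lo → lo < hi → hi < 1 → ∀ n : ℕ, 1 ≤ n → ∀ t ∈ Set.Icc lo hi,
    0 < dP n (pcurve t) t

/-! ### Name-keyed, DEFINITION-FREE forms (what `SubcritExchangeUniformity_of` takes; restatable
verbatim in a `--supports` file: the `let` preamble is the crux's own) -/

namespace Sig

/-- Name-keyed statement of `stub_curveRatioLimit`, definition-free (verbatim the `birth` stub).
[stub statement; by-name consequence of K⁺ ∧ CriticalCurveRegular] -/
def stub_curveRatioLimit : Prop :=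
  let μ := labelMeasure (Site 3)
  let vert : Sym2 (Site 3) → Prop := fun e => ∃ x : Site 3, e = s(x, x + Pi.single (2 : Fin 3) 1)
  let cfg : ℝ → ℝ → (Sym2 (Site 3) → ℝ) → Set (Sym2 (Site 3)) := fun p t U =>
    {e | e ∈ (zdGraph 3).edgeSet ∧ ((vert e ∧ U e ≤ t) ∨ (¬ vert e ∧ U e ≤ p))}
  let Θ : ℕ → ℝ → ℝ → ℝ := fun n p t => μ.real {U | cfg p t U ∈ siteToBoundary 3 n}
  let θ : ℝ → ℝ → ℝ := fun p t => μ.real {U | cfg p t U ∈ percolatesAt (0 : Site 3)}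
  let pc : ℝ → ℝ := fun t => sInf ({p : ℝ | 0 ≤ p ∧ p ≤ 1 ∧ 0 < θ p t} ∪ {1})
  ∀ lo hi : ℝ, 0 < lo → lo < hi → hi < 1 → ∃ σ : ℝ → ℝ, ContinuousOn σ (Set.Icc lo hi) ∧
    ∀ η > (0 : ℝ), ∃ m : ℕ, ∀ n ≥ m, ∀ t ∈ Set.Icc lo hi,
      |deriv (fun s => Θ n (pc t) s) t - σ t * deriv (fun q => Θ n q t) (pc t)| ≤
        η * deriv (fun q => Θ n q t) (pc t)

/-- Name-keyed statement of `stub_lowerSubcurveBound`, definition-free.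
[stub statement; open — LOAD-BEARING for the route's `closes`] -/
def stub_lowerSubcurveBound : Prop :=
  let μ := labelMeasure (Site 3)
  let vert : Sym2 (Site 3) → Prop := fun e => ∃ x : Site 3, e = s(x, x + Pi.single (2 : Fin 3) 1)
  let cfg : ℝ → ℝ → (Sym2 (Site 3) → ℝ) → Set (Sym2 (Site 3)) := fun p t U =>
    {e | e ∈ (zdGraph 3).edgeSet ∧ ((vert e ∧ U e ≤ t) ∨ (¬ vert e ∧ U e ≤ p))}
  let Θ : ℕ → ℝ → ℝ → ℝ := fun n p t => μ.real {U | cfg p t U ∈ siteToBoundary 3 n}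
  let θ : ℝ → ℝ → ℝ := fun p t => μ.real {U | cfg p t U ∈ percolatesAt (0 : Site 3)}
  let pc : ℝ → ℝ := fun t => sInf ({p : ℝ | 0 ≤ p ∧ p ≤ 1 ∧ 0 < θ p t} ∪ {1})
  ∀ lo hi : ℝ, 0 < lo → lo < hi → hi < 1 →
    ∀ η > (0 : ℝ), ∃ δ > (0 : ℝ), ∃ m : ℕ, ∀ n ≥ m, ∀ t ∈ Set.Icc lo hi, ∀ p : ℝ,
      pc t - δ ≤ p → p ≤ pc t →
        deriv (fun s => Θ n (pc t) s) t * deriv (fun q => Θ n q t) p -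
            η * deriv (fun q => Θ n q t) p * deriv (fun q => Θ n q t) (pc t) ≤
          deriv (fun s => Θ n p s) t * deriv (fun q => Θ n q t) (pc t)

/-- Name-keyed statement of `stub_upperSubcurveBound`, definition-free.
[stub statement; open — needed for K⁻ as typed, not for `closes`] -/
def stub_upperSubcurveBound : Prop :=
  let μ := labelMeasure (Site 3)
  let vert : Sym2 (Site 3) → Prop := fun e => ∃ x : Site 3, e = s(x, x + Pi.single (2 : Fin 3) 1)
  let cfg : ℝ → ℝ → (Sym2 (Site 3) → ℝ) → Set (Sym2 (Site 3)) := fun p t U =>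
    {e | e ∈ (zdGraph 3).edgeSet ∧ ((vert e ∧ U e ≤ t) ∨ (¬ vert e ∧ U e ≤ p))}
  let Θ : ℕ → ℝ → ℝ → ℝ := fun n p t => μ.real {U | cfg p t U ∈ siteToBoundary 3 n}
  let θ : ℝ → ℝ → ℝ := fun p t => μ.real {U | cfg p t U ∈ percolatesAt (0 : Site 3)}
  let pc : ℝ → ℝ := fun t => sInf ({p : ℝ | 0 ≤ p ∧ p ≤ 1 ∧ 0 < θ p t} ∪ {1})
  ∀ lo hi : ℝ, 0 < lo → lo < hi → hi < 1 →
    ∀ η > (0 : ℝ), ∃ δ > (0 : ℝ), ∃ m : ℕ, ∀ n ≥ m, ∀ t ∈ Set.Icc lo hi, ∀ p : ℝ,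
      pc t - δ ≤ p → p ≤ pc t →
        deriv (fun s => Θ n p s) t * deriv (fun q => Θ n q t) (pc t) ≤
          deriv (fun s => Θ n (pc t) s) t * deriv (fun q => Θ n q t) p +
            η * deriv (fun q => Θ n q t) p * deriv (fun q => Θ n q t) (pc t)

/-- Name-keyed statement of `stub_slopePositiveOnCurve`, definition-free (verbatim the `birth`
stub). [stub statement; by-name support — follows from the route items `ModelFacts`,
`CriticalCurveRegular`, see `slopePositiveOnCurve_of_items`] -/
def stub_slopePositiveOnCurve : Prop :=
  let μ := labelMeasure (Site 3)
  let vert : Sym2 (Site 3) → Prop := fun e => ∃ x : Site 3, e = s(x, x + Pi.single (2 : Fin 3) 1)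
  let cfg : ℝ → ℝ → (Sym2 (Site 3) → ℝ) → Set (Sym2 (Site 3)) := fun p t U =>
    {e | e ∈ (zdGraph 3).edgeSet ∧ ((vert e ∧ U e ≤ t) ∨ (¬ vert e ∧ U e ≤ p))}
  let Θ : ℕ → ℝ → ℝ → ℝ := fun n p t => μ.real {U | cfg p t U ∈ siteToBoundary 3 n}
  let θ : ℝ → ℝ → ℝ := fun p t => μ.real {U | cfg p t U ∈ percolatesAt (0 : Site 3)}
  let pc : ℝ → ℝ := fun t => sInf ({p : ℝ | 0 ≤ p ∧ p ≤ 1 ∧ 0 < θ p t} ∪ {1})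
  ∀ lo hi : ℝ, 0 < lo → lo < hi → hi < 1 → ∀ n : ℕ, 1 ≤ n → ∀ t ∈ Set.Icc lo hi,
    0 < deriv (fun q => Θ n q t) (pc t)

end Sig

/-- The name-keyed form of STUB 1 is the local form. -/
theorem Sig.stub_curveRatioLimit_iff : Sig.stub_curveRatioLimit ↔ CurveRatioLimit := Iff.rfl

/-- The name-keyed form of STUB 2 is the local form. -/
theorem Sig.stub_lowerSubcurveBound_iff : Sig.stub_lowerSubcurveBound ↔ LowerSubcurveBound :=
  Iff.rfl

/-- The name-keyed form of STUB 3 is the local form. -/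
theorem Sig.stub_upperSubcurveBound_iff : Sig.stub_upperSubcurveBound ↔ UpperSubcurveBound :=
  Iff.rfl

/-- The name-keyed form of STUB 4 is the local form. -/
theorem Sig.stub_slopePositiveOnCurve_iff :
    Sig.stub_slopePositiveOnCurve ↔ SlopePositiveOnCurve := Iff.rfl

/-! ## §2 Registered stubs (the only `sorry`s of the file) -/

/-- **STUB 1 `curveRatioLimit`** (SHARED with `Lines/birth.lean`; BY-NAME CONSEQUENCE of the
route items `SupercritExchangeUniformity ∧ CriticalCurveRegular`, see `curveRatioLimit_of_items`;
from scratch: open-problem, the critical-window ratio limit at `x = 0`). For every compact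
sub-arc `[lo,hi] ⊂ (0,1)` there is `σ` continuous on `[lo,hi]` with: for every `η > 0` there is
`m` such that for all `n ≥ m`, `t ∈ [lo,hi]`,
`|∂_tΘ_n(p_c(t),t) − σ(t) ∂_pΘ_n(p_c(t),t)| ≤ η ∂_pΘ_n(p_c(t),t)`.
[GarbanPeteSchramm2013Pivotal; AizenmanGrimmett1991; doi:10.1103/PhysRevB.27.4394] -/
theorem stub_curveRatioLimit : let μ := labelMeasure (Site 3); let vert : Sym2 (Site 3) → Prop := fun e => ∃ x : Site 3, e = s(x, x + Pi.single (2 : Fin 3) 1); let cfg : ℝ → ℝ → (Sym2 (Site 3) → ℝ) → Set (Sym2 (Site 3)) := fun p t U => {e | e ∈ (zdGraph 3).edgeSet ∧ ((vert e ∧ U e ≤ t) ∨ (¬ vert e ∧ U e ≤ p))}; let Θ : ℕ → ℝ → ℝ → ℝ := fun n p t => μ.real {U | cfg p t U ∈ siteToBoundary 3 n}; let θ : ℝ → ℝ → ℝ := fun p t => μ.real {U | cfg p t U ∈ percolatesAt (0 : Site 3)}; let pc : ℝ → ℝ := fun t => sInf ({p : ℝ | 0 ≤ p ∧ p ≤ 1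 ∧ 0 < θ p t} ∪ {1}); ∀ lo hi : ℝ, 0 < lo → lo < hi → hi < 1 → ∃ σ : ℝ → ℝ, ContinuousOn σ (Set.Icc lo hi) ∧ ∀ η > (0 : ℝ), ∃ m : ℕ, ∀ n ≥ m, ∀ t ∈ Set.Icc lo hi, |deriv (fun s => Θ n (pc t) s) t - σ t * deriv (fun q => Θ n q t) (pc t)| ≤ η * deriv (fun q => Θ n q t) (pc t) := by
  sorry

/-- **STUB 2 `lowerSubcurveBound`** (OPEN — THE LOAD-BEARING HALF: with K⁺ it is all that the
route's deciding theorem consumes from below the curve, cf. `TransportLemmaMono` in §5). For every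
compact sub-arc `[lo,hi] ⊂ (0,1)` and `η > 0` there are `δ > 0`, `m` such that for all `n ≥ m`,
`t ∈ [lo,hi]`, `p_c(t) − δ ≤ p ≤ p_c(t)`:
`∂_tΘ_n(p_c t,t) ∂_pΘ_n(p,t) − η ∂_pΘ_n(p,t) ∂_pΘ_n(p_c t,t) ≤ ∂_tΘ_n(p,t) ∂_pΘ_n(p_c t,t)`,
i.e. `a_n(p,t) ≥ a_n(p_c(t),t) − η`: from the subcritical side a pivotal `z`-bond is never
asymptotically cheaper, against pivotal `x,y`-bonds, than on the curve (no downward face-selection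
/ crossover germ survives at the curve, uniformly in `n`). Size: open-problem (near-critical 3D;
no RSW / IIC coupling; OZ renewal only at fixed `(p,t)`). Why it might fail: a one-signed
NEGATIVE crossover germ `lim_n a_n(p,t) − σ(t) ≤ −c < 0` persisting as `p ↑ p_c(t)` (excluded by
the single-relevant-field picture, which gives `O(p_c(t) − p)`), or a negative `O(1)` dip of the
lower window profile. [CampaninoIoffeVelenik2008; AizenmanGrimmett1991; Grimmett1999 §6.2;
arXiv:0712.3412; doi:10.1103/PhysRevB.27.4394] -/
theorem stub_lowerSubcurveBound : let μ := labelMeasure (Site 3); let vert : Sym2 (Site 3) → Prop := fun e => ∃ x : Site 3, e = s(x, x + Pi.single (2 : Fin 3) 1); let cfg : ℝ → ℝ → (Sym2 (Site 3) → ℝ) → Set (Sym2 (Site 3)) := fun p t U => {e | e ∈ (zdGraph 3).edgeSet ∧ ((vert e ∧ U e ≤ t) ∨ (¬ vert e ∧ U e ≤ p))}; let Θ : ℕ → ℝ → ℝ → ℝ := fun n p t => μ.real {U | cfg p t U ∈ siteToBoundary 3 n}; let θ : ℝ → ℝ → ℝ := fun p t => μ.real {U | cfg p t U ∈ percolatesAt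 (0 : Site 3)}; let pc : ℝ → ℝ := fun t => sInf ({p : ℝ | 0 ≤ p ∧ p ≤ 1 ∧ 0 < θ p t} ∪ {1}); ∀ lo hi : ℝ, 0 < lo → lo < hi → hi < 1 → ∀ η > (0 : ℝ), ∃ δ > (0 : ℝ), ∃ m : ℕ, ∀ n ≥ m, ∀ t ∈ Set.Icc lo hi, ∀ p : ℝ, pc t - δ ≤ p → p ≤ pc t → deriv (fun s => Θ n (pc t) s) t * deriv (fun q => Θ n q t) p - η * deriv (fun q => Θ n q t) p * deriv (fun q => Θ n q t) (pc t) ≤ deriv (fun s => Θ n p s) t * deriv (fun q => Θ n q t) (pc t) := by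
  sorry

/-- **STUB 3 `upperSubcurveBound`** (OPEN — needed for K⁻ AS TYPED; NOT consumed by the route's
`closes`, only by the lower pinch `p_c ∈ C¹` / "J nondecreasing"). For every compact sub-arc
`[lo,hi] ⊂ (0,1)` and `η > 0` there are `δ > 0`, `m` such that for all `n ≥ m`, `t ∈ [lo,hi]`,
`p_c(t) − δ ≤ p ≤ p_c(t)`:
`∂_tΘ_n(p,t) ∂_pΘ_n(p_c t,t) ≤ ∂_tΘ_n(p_c t,t) ∂_pΘ_n(p,t) + η ∂_pΘ_n(p,t) ∂_pΘ_n(p_c t,t)`,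
i.e. `a_n(p,t) ≤ a_n(p_c(t),t) + η`. Size: open-problem (same technology gap as stub 2). Why it
might fail: a one-signed POSITIVE crossover germ or window bump. [CampaninoIoffeVelenik2008;
AizenmanGrimmett1991; Grimmett1999 §6.2; arXiv:0712.3412] -/
theorem stub_upperSubcurveBound : let μ := labelMeasure (Site 3); let vert : Sym2 (Site 3) → Prop := fun e => ∃ x : Site 3, e = s(x, x + Pi.single (2 : Fin 3) 1); let cfg : ℝ → ℝ → (Sym2 (Site 3) → ℝ) → Set (Sym2 (Site 3)) := fun p t U => {e | e ∈ (zdGraph 3).edgeSet ∧ ((vert e ∧ U e ≤ t) ∨ (¬ vert e ∧ U e ≤ p))}; let Θ : ℕ → ℝ → ℝ → ℝ := fun n p t => μ.real {U | cfg p t U ∈ siteToBoundary 3 n}; let θ : ℝ → ℝ → ℝ := fun p t => μ.real {U | cfg p t U ∈ percolatesAt (0 : Site 3)}; let pc : ℝ → ℝ := fun t => sInf ({p : ℝ | 0 ≤ p ∧ p ≤ 1 ∧ 0 < θ p t} ∪ {1}); ∀ lo hi : ℝ, 0 < lo → lo < hi → hi < 1 → ∀ η > (0 : ℝ), ∃ δ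 > (0 : ℝ), ∃ m : ℕ, ∀ n ≥ m, ∀ t ∈ Set.Icc lo hi, ∀ p : ℝ, pc t - δ ≤ p → p ≤ pc t → deriv (fun s => Θ n p s) t * deriv (fun q => Θ n q t) (pc t) ≤ deriv (fun s => Θ n (pc t) s) t * deriv (fun q => Θ n q t) p + η * deriv (fun q => Θ n q t) p * deriv (fun q => Θ n q t) (pc t) := by
  sorry

/-- **STUB 4 `slopePositiveOnCurve`** (SHARED with `Lines/birth.lean`; by-name SUPPORT from the
route items `ModelFacts ∧ CriticalCurveRegular`, see `slopePositiveOnCurve_of_items`). For every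
compact sub-arc `[lo,hi] ⊂ (0,1)`, all `n ≥ 1` and `t ∈ [lo,hi]`: `0 < ∂_pΘ_n(p_c(t),t)`.
[Grimmett1999 §2.4; AizenmanGrimmett1991; ChayesSchonmann2000] -/
theorem stub_slopePositiveOnCurve : let μ := labelMeasure (Site 3); let vert : Sym2 (Site 3) → Prop := fun e => ∃ x : Site 3, e = s(x, x + Pi.single (2 : Fin 3) 1); let cfg : ℝ → ℝ → (Sym2 (Site 3) → ℝ) → Set (Sym2 (Site 3)) := fun p t U => {e | e ∈ (zdGraph 3).edgeSet ∧ ((vert e ∧ U e ≤ t) ∨ (¬ vert e ∧ U e ≤ p))}; let Θ : ℕ → ℝ → ℝ → ℝ := fun n p t => μ.real {U | cfg p t U ∈ siteToBoundary 3 n}; let θ : ℝ → ℝ → ℝ := fun p t => μ.real {U | cfg p t U ∈ percolatesAt (0 : Site 3)}; let pc : ℝ → ℝ := fun t => sInf ({p : ℝ | 0 ≤ p ∧ p ≤ 1 ∧ 0 < θ p t} ∪ {1}); ∀ lo hi : ℝ, 0 < lo → lo < hi → hi < 1 → ∀ n : ℕ, 1 ≤ n → ∀ t ∈ Set.Icc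 lo hi, 0 < deriv (fun q => Θ n q t) (pc t) := by
  exact Summit.CriticalPhenomena.PercolationContinuityZ3.Theorems.SubcritExchangeUniformity.stub_slopePositiveOnCurve

/-- Definitional consistency: the registered stubs prove their name-keyed statements. -/
example : Sig.stub_curveRatioLimit := stub_curveRatioLimit
example : Sig.stub_lowerSubcurveBound := stub_lowerSubcurveBound
example : Sig.stub_upperSubcurveBound := stub_upperSubcurveBound
example : Sig.stub_slopePositiveOnCurve := stub_slopePositiveOnCurve

/-! ## §3 Proved plumbing: stubs 1 and 4 from the route items; the percolation-free glue -/

/-- **STUB 1 is a by-name consequence of the sibling crux K⁺ and `CriticalCurveRegular`.** K⁺ is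
stated on the CLOSED supercritical collar `{p_c(t) ≤ p ≤ p_c(t)+ρ}`, curve included: take
`σ t := a (p_c t) t`, continuous on `[lo,hi]` as the composite of the collar-continuous field
with the continuous curve `t ↦ (p_c t, t)` (`CriticalCurveRegular`: `p_c` continuous on `(0,1)`),
and specialise the exchange-rate inequality to `p = p_c(t)`. -/
theorem curveRatioLimit_of_items (hSup : SupercritExchangeUniformity)
    (hCC : CriticalCurveRegular) : CurveRatioLimit := by
  rw [supercritExchangeUniformity_iff] at hSup
  rw [criticalCurveRegular_iff] at hCC
  obtain ⟨hpc, -⟩ := hCC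
  intro lo hi hlo hlh hhi
  obtain ⟨ρ, hρ, L, a, hcont, -, hrate⟩ := hSup lo hi hlo hlh hhi
  have hsub : Set.Icc lo hi ⊆ Set.Ioo (0 : ℝ) 1 := fun t ht =>
    ⟨hlo.trans_le ht.1, ht.2.trans_lt hhi⟩
  have hγ : ContinuousOn (fun t : ℝ => ((pcurve t, t) : ℝ × ℝ)) (Set.Icc lo hi) :=
    ((hpc.mono hsub).prodMk continuousOn_id)
  have hmaps : Set.MapsTo (fun t : ℝ => ((pcurve t, t) : ℝ × ℝ)) (Set.Icc lo hi)
      {x : ℝ × ℝ | x.2 ∈ Set.Icc lo hi ∧ pcurve x.2 ≤ x.1 ∧ x.1 ≤ pcurve x.2 + ρ} := by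
    intro t ht
    exact ⟨ht, le_rfl, by linarith⟩
  refine ⟨fun t => a (pcurve t) t, hcont.comp hγ hmaps, fun η hη => ?_⟩
  obtain ⟨m, hm⟩ := hrate η hη
  exact ⟨m, fun n hn t ht => hm n hn t ht (pcurve t) le_rfl (by linarith)⟩

/-- **STUB 1 modulo K⁺ alone** (integration, cycle 1): `CriticalCurveRegular` is PROVED in the tree
(`Cruxes.CriticalCurveRegular.Locmod.CriticalCurveRegular_proof`, Theorems/…CriticalCurveRegular.lean) and the
conditional derivation `Theorems.SubcritExchangeUniformity.curveRatioLimit_of_items : K⁺ → CCR → Sig.stub_curveRatioLimit`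
is LANDED (p166335), so the on-curve ratio limit is exactly as open as the sibling crux
`SupercritExchangeUniformity` (stmt-CriticalPhenomena-16061). -/
theorem stub_curveRatioLimit_of_supercrit (hSup : SupercritExchangeUniformity) : Sig.stub_curveRatioLimit :=
  Summit.CriticalPhenomena.PercolationContinuityZ3.Theorems.SubcritExchangeUniformity.curveRatioLimit_of_items hSup
    Summit.CriticalPhenomena.PercolationContinuityZ3.Cruxes.CriticalCurveRegular.Locmod.CriticalCurveRegular_proof

/-- STUB 4's statement is now an unconditional tree theorem (landed p168651; uses the landed Russo
positivity `thetaBox_deriv_p_pos` = `ModelFacts` clause (8) and `pc_mem_Ioo` = `CriticalCurveRegular` clause (2)). -/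
theorem slopePositiveOnCurve_holds : SlopePositiveOnCurve :=
  Sig.stub_slopePositiveOnCurve_iff.1
    Summit.CriticalPhenomena.PercolationContinuityZ3.Theorems.SubcritExchangeUniformity.stub_slopePositiveOnCurve

/-- STUB 4 is by-name support: it follows from the route items `ModelFacts` (conjunct 8: Russo
positivity of `∂_pΘ_n` on the open square for `n ≥ 1`) and `CriticalCurveRegular` (conjunct 2:
`0 < p_c(t) < 1` on `(0,1)`). (Verbatim the `birth` derivation.) -/
theorem slopePositiveOnCurve_of_items (hMF : ModelFacts) (hCC : CriticalCurveRegular) :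
    SlopePositiveOnCurve := by
  obtain ⟨-, -, -, -, -, -, -, h8, -, -⟩ := hMF
  obtain ⟨-, h2⟩ := hCC
  intro lo hi hlo _ hhi n hn t ht
  have ht' : t ∈ Set.Ioo (0 : ℝ) 1 := ⟨hlo.trans_le ht.1, ht.2.trans_lt hhi⟩
  exact h8 n hn (pcurve t) ⟨(h2 t ht').1, (h2 t ht').2⟩ t ht'

/-- **The percolation-free core of the composition** (`dT`, `dP`, `pc` abstract). From an
on-curve limit `|T − σD| ≤ (η/2)D`, the two ONE-SIDED sub-curve bounds
`T d − (η/2) d D ≤ τ D ≤ T d + (η/2) d D` and `D > 0`: `d ≥ 0` and `|τ − σ d| ≤ η d`. -/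
theorem onesided_glue {dT dP : ℕ → ℝ → ℝ → ℝ} {pc : ℝ → ℝ} {lo hi : ℝ}
    (h1 : ∃ σ : ℝ → ℝ, ContinuousOn σ (Set.Icc lo hi) ∧ ∀ η > (0 : ℝ), ∃ m : ℕ, ∀ n ≥ m,
      ∀ t ∈ Set.Icc lo hi, |dT n (pc t) t - σ t * dP n (pc t) t| ≤ η * dP n (pc t) t)
    (h2 : ∀ η > (0 : ℝ), ∃ δ > (0 : ℝ), ∃ m : ℕ, ∀ n ≥ m, ∀ t ∈ Set.Icc lo hi, ∀ p : ℝ,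
      pc t - δ ≤ p → p ≤ pc t →
        dT n (pc t) t * dP n p t - η * dP n p t * dP n (pc t) t ≤ dT n p t * dP n (pc t) t)
    (h3 : ∀ η > (0 : ℝ), ∃ δ > (0 : ℝ), ∃ m : ℕ, ∀ n ≥ m, ∀ t ∈ Set.Icc lo hi, ∀ p : ℝ,
      pc t - δ ≤ p → p ≤ pc t →
        dT n p t * dP n (pc t) t ≤ dT n (pc t) t * dP n p t + η * dP n p t * dP n (pc t) t)
    (h4 : ∀ n : ℕ, 1 ≤ n → ∀ t ∈ Set.Icc lo hi, 0 < dP n (pc t) t) :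
    ∃ σ : ℝ → ℝ, ContinuousOn σ (Set.Icc lo hi) ∧ ∀ η > (0 : ℝ), ∃ δ > (0 : ℝ), ∃ m : ℕ,
      ∀ n ≥ m, ∀ t ∈ Set.Icc lo hi, ∀ p : ℝ, pc t - δ ≤ p → p ≤ pc t →
        |dT n p t - σ t * dP n p t| ≤ η * dP n p t := by
  obtain ⟨σ, hσ, h1⟩ := h1
  refine ⟨σ, hσ, fun η hη => ?_⟩
  have hη2 : (0 : ℝ) < η / 2 := half_pos hη
  obtain ⟨m₁, hm₁⟩ := h1 (η / 2) hη2
  obtain ⟨δ₂, hδ₂, m₂, hm₂⟩ := h2 (η / 2) hη2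
  obtain ⟨δ₃, hδ₃, m₃, hm₃⟩ := h3 (η / 2) hη2
  refine ⟨min δ₂ δ₃, lt_min hδ₂ hδ₃, max (max m₁ (max m₂ m₃)) 1,
    fun n hn t ht p hp₁ hp₂ => ?_⟩
  have hn₁ : m₁ ≤ n := le_trans ((le_max_left _ _).trans (le_max_left _ _)) hn
  have hn₂ : m₂ ≤ n :=
    le_trans (((le_max_left _ _).trans (le_max_right _ _)).trans (le_max_left _ _)) hn
  have hn₃ : m₃ ≤ n :=
    le_trans (((le_max_right _ _).trans (le_max_right _ _)).trans (le_max_left _ _)) hn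
  have hn₄ : 1 ≤ n := le_trans (le_max_right _ _) hn
  have hp₂' : pc t - δ₂ ≤ p := by linarith [min_le_left δ₂ δ₃]
  have hp₃' : pc t - δ₃ ≤ p := by linarith [min_le_right δ₂ δ₃]
  have hD : 0 < dP n (pc t) t := h4 n hn₄ t ht
  have hA : |dT n (pc t) t - σ t * dP n (pc t) t| ≤ η / 2 * dP n (pc t) t := hm₁ n hn₁ t ht
  have hB : dT n (pc t) t * dP n p t - η / 2 * dP n p t * dP n (pc t) t ≤
      dT n p t * dP n (pc t) t := hm₂ n hn₂ t ht p hp₂' hp₂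
  have hC : dT n p t * dP n (pc t) t ≤
      dT n (pc t) t * dP n p t + η / 2 * dP n p t * dP n (pc t) t := hm₃ n hn₃ t ht p hp₃' hp₂
  -- abbreviations
  set D := dP n (pc t) t with hDdef
  set d := dP n p t with hddef
  set T := dT n (pc t) t with hTdef
  set τ := dT n p t with hτdef
  -- the two one-sided inequalities force `d ≥ 0`
  have hd : 0 ≤ d := by
    by_contra hneg
    have hlt : d < 0 := not_le.mp hneg
    have h' : η / 2 * d * D < 0 := mul_neg_of_neg_of_pos (mul_neg_of_pos_of_neg hη2 hlt) hD
    linarith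
  -- the two one-sided inequalities are the two halves of `|τD − Td| ≤ (η/2) d D`
  have hB' : |τ * D - T * d| ≤ η / 2 * d * D := by
    rw [abs_le]; constructor <;> linarith
  -- multiply the target by `D > 0` and split
  have key : |τ - σ t * d| * D ≤ η * d * D := by
    have e : (τ - σ t * d) * D = (τ * D - T * d) + d * (T - σ t * D) := by ring
    calc |τ - σ t * d| * D = |(τ - σ t * d) * D| := by rw [abs_mul, abs_of_pos hD]
      _ = |(τ * D - T * d) + d * (T - σ t * D)| := by rw [e]
      _ ≤ |τ * D - T * d| + |d * (T - σ t * D)| := abs_add_le _ _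
      _ = |τ * D - T * d| + d * |T - σ t * D| := by rw [abs_mul d, abs_of_nonneg hd]
      _ ≤ η / 2 * d * D + d * (η / 2 * D) := add_le_add hB' (mul_le_mul_of_nonneg_left hA hd)
      _ = η * d * D := by ring
  exact le_of_mul_le_mul_right key hD

/-! ## §4 The composition (proved): the four stubs imply the crux BY NAME -/

/-- **`SubcritExchangeUniformity` from the three OPEN registered stubs** (STUB 4 discharged in-tree; hypotheses = the declared
stub `Prop`s by name; conclusion = the route decl `PercExchangeRateTransport.SubcritExchangeUniformity`
by name; no `sorry`): `σ` from STUB 1, the two one-sided bounds at `η/2`, divided by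
`∂_pΘ_n(p_c(t),t) > 0` (STUB 4) via `onesided_glue`. -/
theorem SubcritExchangeUniformity_of (h1 : Sig.stub_curveRatioLimit)
    (h2 : Sig.stub_lowerSubcurveBound) (h3 : Sig.stub_upperSubcurveBound) :
    Summit.CriticalPhenomena.PercolationContinuityZ3.Theses.PercExchangeRateTransport.SubcritExchangeUniformity := by
  -- STUB 4 is a tree theorem since cycle 1 (p168651): no longer a hypothesis of the composition.
  have h4 : Sig.stub_slopePositiveOnCurve := stub_slopePositiveOnCurve
  have h1' : CurveRatioLimit := Sig.stub_curveRatioLimit_iff.1 h1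
  have h2' : LowerSubcurveBound := Sig.stub_lowerSubcurveBound_iff.1 h2
  have h3' : UpperSubcurveBound := Sig.stub_upperSubcurveBound_iff.1 h3
  have h4' : SlopePositiveOnCurve := Sig.stub_slopePositiveOnCurve_iff.1 h4
  rw [subcritExchangeUniformity_iff]
  intro lo hi hlo hlh hhi
  exact onesided_glue (dT := dT) (dP := dP) (pc := pcurve)
    (h1' lo hi hlo hlh hhi) (h2' lo hi hlo hlh hhi) (h3' lo hi hlo hlh hhi) (h4' lo hi hlo hlh hhi)

/-- Wiring check: the registered stubs feed `SubcritExchangeUniformity_of` as stated — the skeleton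
IS the crux proof once the four sorries go. -/
example :
    Summit.CriticalPhenomena.PercolationContinuityZ3.Theses.PercExchangeRateTransport.SubcritExchangeUniformity :=
  SubcritExchangeUniformity_of stub_curveRatioLimit stub_lowerSubcurveBound stub_upperSubcurveBound

/-- **Route-relative reading** (proved): given the sibling crux K⁺ and the route items
`ModelFacts`, `CriticalCurveRegular`, the crux K⁻ follows from the two one-sided sub-curve bounds
alone — stubs 1 and 4 are discharged by name. -/
theorem SubcritExchangeUniformity_of_items (hSup : SupercritExchangeUniformity) (hMF : ModelFacts)
    (hCC : CriticalCurveRegular) (h2 : Sig.stub_lowerSubcurveBound)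
    (h3 : Sig.stub_upperSubcurveBound) :
    Summit.CriticalPhenomena.PercolationContinuityZ3.Theses.PercExchangeRateTransport.SubcritExchangeUniformity :=
  SubcritExchangeUniformity_of (Sig.stub_curveRatioLimit_iff.2 (curveRatioLimit_of_items hSup hCC)) h2 h3

/-! ## §5 Why stub 2 is the load-bearing half: the one-sided transport lemma (typed, not a stub)

The route's deciding theorem `closes` uses `CurveInvariance` (J constant on compact sub-arcs) only
through `J(p₃) ≤ J(lo)` for `lo < p₃`, i.e. through "J NONINCREASING in t". The abstract
real-variable statement below — the one-sided sharpening of the route item `TransportLemma` — has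
exactly the hypotheses K⁺ (two-sided, with the Lipschitz clause, on the closed right collar) and
the LOWER sub-curve bound relative to the curve value `a (pc t) t` of the field (which K⁺ and
`stub_lowerSubcurveBound` supply after division by `∂_pΘ_n(p_c t,t) > 0`), and concludes
monotonicity of `t ↦ Θ_∞(pc t, t)`. Proof sketch (informal, ≈ 3 pages; NOT claimed here):
(i) UPPER PINCH — from `(pc t₀ + ε, t₀)` the straight test segment of slope
`−(a(pc t₀,t₀) − 2η)` keeps every `Θ_n`, `n ≥ m`, nondecreasing while it stays in
collar ∪ strip (it does for `|t − t₀| ≤ τ₀(η)`, by uniform continuity of `pc` and `a`): above the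
curve by K⁺, below it by the LOWER bound; the threshold property then gives
`pc t ≤ pc t₀ − (a(pc t₀,t₀) − 2η)(t − t₀)` on `[t₀, t₀+τ₀]`; (ii) LEVEL TRANSPORT — forward Euler
polygons of slope `−(a(vertex) + 2η)` from `(pc t₀ + ε, t₀)` make every `Θ_n` nonincreasing
(K⁺ only: they live above the curve), their gap to the curve obeys
`D_{k+1} ≥ (1 − Lh) D_k − 4ηh` by (i) and the Lipschitz clause, so they stay above the curve for
`η ≪ ε e^{−L(hi−lo)}`; when `D_k > ρ/2` restart from `pc τ_k + ε` — restarting DOWNWARDS only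
decreases `Θ` (monotone in `p`), so the chain of inequalities is free; (iii) `ε ↓ 0` through
right-continuity of `q ↦ ⨅ n, Θ n q t` (inf of continuous nondecreasing functions). Neither the
lower pinch, nor `pc ∈ C¹`, nor any UPPER sub-curve bound is used. Recorded so that a tenure
planner can re-glue `closes` through it (`SubcritExchangeUniformity` ↦ stub 2's statement,
`TransportLemma` ↦ `TransportLemmaMono`, `CurveInvariance` ↦ "J nonincreasing"); it is not an item
of any route and not a stub of this line. -/

/-- The ONE-SIDED abstract transport lemma (real analysis, percolation-free). **PROVED** (lead c1, cycle 2):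
`Theorems.SubcritExchangeUniformity.TransportMono.transportLemmaMono` has exactly this statement (assembly of
`rightCollar_moduli` p172345, `upperFenceMono` p172389, `levelTransportMono` p172745 and `TransportLemma.rightContinuity`);
kept here as a `Prop` so that the skeleton does not import the new modules. Compared with the route item
`TransportLemma`: the exchange-rate hypothesis below the curve is the one-sided
`(a (pc t) t − η) ∂_pΘ_n ≤ ∂_tΘ_n` on the `δ(η)`-strip, and the conclusion is monotonicity
(`s ≤ t ⇒ Θ_∞(pc t, t) ≤ Θ_∞(pc s, s)`) instead of constancy. -/
def TransportLemmaMono : Prop :=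
  ∀ (Θ : ℕ → ℝ → ℝ → ℝ) (pc : ℝ → ℝ) (a : ℝ → ℝ → ℝ) (lo hi ρ L : ℝ), 0 < lo → lo < hi → hi < 1 →
    0 < ρ → (∀ n, ContDiffOn ℝ 1 (fun x : ℝ × ℝ => Θ n x.1 x.2) (Set.Ioo 0 1 ×ˢ Set.Ioo 0 1)) →
    (∀ n t, Monotone (fun p => Θ n p t)) → (∀ n p, Monotone (fun t => Θ n p t)) →
    (∀ p t, Antitone (fun n => Θ n p t)) → (∀ n p t, 0 ≤ Θ n p t) →
    ContinuousOn pc (Set.Icc lo hi) → (∀ t ∈ Set.Icc lo hi, ρ < pc t ∧ pc t + ρ < 1) →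
    (∀ t ∈ Set.Icc lo hi, ∀ p : ℝ,
      (p < pc t → (⨅ n, Θ n p t) = 0) ∧ (pc t < p → 0 < ⨅ n, Θ n p t)) →
    ContinuousOn (fun x : ℝ × ℝ => a x.1 x.2)
      {x : ℝ × ℝ | x.2 ∈ Set.Icc lo hi ∧ pc x.2 ≤ x.1 ∧ x.1 ≤ pc x.2 + ρ} →
    (∀ t ∈ Set.Icc lo hi, ∀ p q : ℝ, pc t ≤ p → p ≤ pc t + ρ → pc t ≤ q → q ≤ pc t + ρ →
      |a p t - a q t| ≤ L * |p - q|) →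
    (∀ η > (0 : ℝ), ∃ m : ℕ, ∀ n ≥ m, ∀ t ∈ Set.Icc lo hi, ∀ p : ℝ, pc t ≤ p → p ≤ pc t + ρ →
      |deriv (fun s => Θ n p s) t - a p t * deriv (fun q => Θ n q t) p| ≤
        η * deriv (fun q => Θ n q t) p) →
    (∀ η > (0 : ℝ), ∃ δ > (0 : ℝ), ∃ m : ℕ, ∀ n ≥ m, ∀ t ∈ Set.Icc lo hi, ∀ p : ℝ,
      pc t - δ ≤ p → p ≤ pc t →
        (a (pc t) t - η) * deriv (fun q => Θ n q t) p ≤ deriv (fun s => Θ n p s) t) →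
    ∀ s t : ℝ, s ∈ Set.Icc lo hi → t ∈ Set.Icc lo hi → s ≤ t →
      (⨅ n, Θ n (pc t) t) ≤ ⨅ n, Θ n (pc s) s

/-- The crux-level counterpart fed to `TransportLemmaMono` by this line: K⁺'s on-curve field value
and STUB 2 give the one-sided sub-curve hypothesis in the model (division by STUB 4's positive
slope). Stated as a `Prop` over the local names; `lowerBuffer_of_stubs` proves it from K⁺ and
stubs 2, 4. -/
def LowerBuffer : Prop :=
  ∀ lo hi : ℝ, 0 < lo → lo < hi → hi < 1 → ∃ σ : ℝ → ℝ, ContinuousOn σ (Set.Icc lo hi) ∧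
    (∀ η > (0 : ℝ), ∃ m : ℕ, ∀ n ≥ m, ∀ t ∈ Set.Icc lo hi,
      |dT n (pcurve t) t - σ t * dP n (pcurve t) t| ≤ η * dP n (pcurve t) t) ∧
    ∀ η > (0 : ℝ), ∃ δ > (0 : ℝ), ∃ m : ℕ, ∀ n ≥ m, ∀ t ∈ Set.Icc lo hi, ∀ p : ℝ,
      pcurve t - δ ≤ p → p ≤ pcurve t → (σ t - η) * dP n p t ≤ dT n p t

/-- **`LowerBuffer` from the route items K⁺, `ModelFacts`, `CriticalCurveRegular` and STUB 2
alone** (no STUB 3): the division step, recorded to certify that the load-bearing sub-curve input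
of the route's deciding theorem is exactly STUB 2 (`ModelFacts` conjunct 3, monotonicity in `p`,
supplies `0 ≤ ∂_pΘ_n(p,t)`; K⁺ ∧ `CriticalCurveRegular` supply STUB 1; `ModelFacts` ∧
`CriticalCurveRegular` supply STUB 4). -/
theorem lowerBuffer_of_items (hSup : SupercritExchangeUniformity) (hMF : ModelFacts)
    (hCC : CriticalCurveRegular) (h2 : LowerSubcurveBound) : LowerBuffer := by
  have h1 : CurveRatioLimit := curveRatioLimit_of_items hSup hCC
  have h4 : SlopePositiveOnCurve := slopePositiveOnCurve_of_items hMF hCC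
  obtain ⟨-, -, h3mono, -⟩ := hMF
  intro lo hi hlo hlh hhi
  obtain ⟨σ, hσ, h1⟩ := h1 lo hi hlo hlh hhi
  refine ⟨σ, hσ, h1, fun η hη => ?_⟩
  have hη2 : (0 : ℝ) < η / 2 := half_pos hη
  obtain ⟨m₁, hm₁⟩ := h1 (η / 2) hη2
  obtain ⟨δ, hδ, m₂, hm₂⟩ := h2 lo hi hlo hlh hhi (η / 2) hη2
  refine ⟨δ, hδ, max (max m₁ m₂) 1, fun n hn t ht p hp₁ hp₂ => ?_⟩
  have hn₁ : m₁ ≤ n := le_trans ((le_max_left _ _).trans (le_max_left _ _)) hn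
  have hn₂ : m₂ ≤ n := le_trans ((le_max_right _ _).trans (le_max_left _ _)) hn
  have hn₄ : 1 ≤ n := le_trans (le_max_right _ _) hn
  have hD : 0 < dP n (pcurve t) t := h4 lo hi hlo hlh hhi n hn₄ t ht
  have hd : 0 ≤ dP n p t := (h3mono n t).deriv_nonneg
  have hA := hm₁ n hn₁ t ht
  have hB := hm₂ n hn₂ t ht p hp₁ hp₂
  set D := dP n (pcurve t) t
  set d := dP n p t
  set T := dT n (pcurve t) t
  set τ := dT n p t
  -- from |T − σD| ≤ (η/2) D:  σ D − (η/2) D ≤ T; multiply by d ≥ 0, add STUB 2, divide by D > 0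
  have hA' : σ t * D - η / 2 * D ≤ T := by
    have := (abs_le.mp hA).1; linarith
  have h1' : (σ t * D - η / 2 * D) * d ≤ T * d := mul_le_mul_of_nonneg_right hA' hd
  have key : ((σ t - η) * d) * D ≤ τ * D := by nlinarith
  exact le_of_mul_le_mul_right key hD

end Summit.CriticalPhenomena.PercolationContinuityZ3.Cruxes.SubcritExchangeUniformity.Onesided

end
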